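import Mathlib
import HarnessLib
import Literature.Probability.MarkovChains.SingleSiteUpdateDomination
import Literature.Probability.MarkovChains.IsingGlauberMonotone
import Literature.Probability.MarkovChains.SeparationDistance
import Literature.Probability.MarkovChains.CouponCollectorTail

/-!
# Glauber dynamics of a monotone spin system started from the top state: `Pᵗ(⊕,⊖) ≤ π(⊖)·P{τ_cov ≤ t}` and `s(t) ≥ 1 − P{τ_cov ≤ t}` (Levin–Peres–Wilmer Exercise 22.7 (a)–(c))

HONEST FRAMING: exact (Metropolis-corrected) sampling algorithms for lattice gauge theory; figures
of merit are autocorrelation/cost numbers at stated couplings and volumes; no continuum-physics claim.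

Topic `Probability/MarkovChains`; namespace `Literature.Probability.MarkovChains`.  Vocabulary of
`GlauberDynamics.lean` (`glauberSiteLaw π x v ·` = the single-site heat-bath law `P_v(x,·)`,
`glauberKernel π = |V|⁻¹ Σ_v P_v`, `AgreeOff`), `TotalVariation.lean` (`stepLaw`, `lawAt`),
`MixingTimeSubmultiplicative.lean` (`kernelAt P t x y = Pᵗ(x,y)`), `BottleneckRatio.lean`
(`worstTvDist = d(t)`), `SeparationDistance.lean` (`sepDistFrom = s_x(t)`, `sepDist = s(t)`,
Lemma 6.17), `StochasticDomination.lean` (`IsMonotoneChain`), `SingleSiteUpdateDomination.lean`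
(Lemma 22.21) and `IsingGlauberMonotone.lean` (Example 22.9).  Configurations `σ : V → S` over a finite
totally ordered spin set `S`; `top, bot : S` with `bot < top` and `s ≤ top` for all `s`; `⊕ = (v ↦ top)`,
`⊖ = (v ↦ bot)`; `π > 0` on `S^V`.  Source: D. A. Levin, Y. Peres (with E. L. Wilmer), *Markov Chains
and Mixing Times*, 2nd ed., AMS 2017 [LevinPeres2017], §22.9 Exercise 22.7 (pp. 321–322; "The
argument outlined in Exercise 22.7 is due to Evita Nestoridi", §22.10), printed for the Glauber
dynamics of the Ising model and typed here for every monotone single-site heat-bath system, with the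
Ising model as the instance.  EVERYTHING IS PROVED (0 named facts); the exercise's hints are followed.

* `lawAt_glauberKernel_eq_avg` — the random-scan dynamics after `t` steps is the uniform average over
  the `|V|ᵗ` site sequences `(v₁,…,v_t)` (as `f : Fin t → V`) of the laws `μ_{v₁…v_t}` obtained by
  updating at `v₁, …, v_t` in turn [cite: LevinPeres2017, §22.9 Exercise 22.7 (b) hint ("Condition on
  the sequence of updated vertices `v₁, v₂, …, v_t`")];
* `foldl_update_apply_eq_zero` — if a site `w` is not among the updated sites, `μ_{v₁…v_t}` (from `⊕`)
  gives no mass to configurations with `σ(w) ≠ top` [cite: LevinPeres2017, §22.9 Exercise 22.7 (b)–(c)];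
* **(a)** `LevinPeres2017_exercise_22_7_a` — for a monotone system, `μ_{v₁…v_t}(⊖) ≤ π(⊖)` ("apply
  Lemma 22.21 `t` times": `μ_t/π` stays increasing and has `π`-mean `1`, so its value at the bottom
  state is `≤ 1`) [cite: LevinPeres2017, §22.9 Exercise 22.7 (a)];
* **(b)–(c)** `LevinPeres2017_exercise_22_7_b` — **`Pᵗ(⊕,⊖) ≤ π(⊖) · N_cov(t)/|V|ᵗ`**, and
  `LevinPeres2017_exercise_22_7_c` — **`s(t) ≥ s_⊕(t) ≥ 1 − N_cov(t)/|V|ᵗ`**, where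
  `N_cov(t) = #{f : Fin t → V surjective}` so that `N_cov(t)/|V|ᵗ = P{τ_cov ≤ t}` is the
  coupon-collector probability that `t` uniform site choices refresh every site
  [cite: LevinPeres2017, §22.9 Exercise 22.7 (b), (c) (`s(t) ≥ 1 − Pᵗ(⊕,⊖)/π(⊖) ≥ 1 − P{τ ≤ t}`)];
* `LevinPeres2017_exercise_22_7_tv` — with Lemma 6.17 (`s(2t) ≤ 1 − (1 − d̄(t))² ≤ 2d̄(t) ≤ 4d(t)`,
  the heat-bath dynamics being reversible): **`1 − N_cov(2t)/|V|^{2t} ≤ 4 d(t)`**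
  [cite: LevinPeres2017, §22.9 Exercise 22.7 (e) hint ("Use Lemma 6.17")];
* `LevinPeres2017_exercise_22_7_ising` — the instance for the Glauber dynamics of the ferromagnetic
  Ising model (`β ≥ 0`, any finite graph with at least one vertex), monotone by Example 22.9
  [cite: LevinPeres2017, §22.9 Exercise 22.7].
* **(d)–(e)** with the coupon-collector lower tail of `CouponCollectorTail.lean` (Lemma 7.13 +
  Chebyshev: `N_cov(t)/nᵗ ≤ e^{−c}` for `t ≤ (n−1)(log n − c)`, `n = |V| ≥ 2`):
  `LevinPeres2017_exercise_22_7_d` — **`s(t) ≥ 1 − e^{−c}` for `t ≤ (n−1)(log n − c)`**;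
  `LevinPeres2017_exercise_22_7_e` — **`4d(t) ≥ 1 − e^{−c}` for `2t ≤ (n−1)(log n − c)`**, hence
  **`t_mix(ε) > t` whenever `2t ≤ (n−1)(log n − c)` and `e^{−c} < 1 − 4ε`**, i.e.
  `t_mix(ε) ≥ ½(n−1)(log n − log(1/(1−4ε)))` for `ε < ¼` — the printed "`t_mix(ε) ≥ n log(n)/2 − O(n)`"
  [cite: LevinPeres2017, §22.9 Exercise 22.7 (d), (e) ("In particular, for `t = n log(n) − c_δ n`, we
  have `s(t) ≥ 1 − δ`"; "Deduce that for any `ε < 1/2` we have `t_mix(ε) ≥ n log(n)/2 − O(n)`")].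
  SCOPE (declared): the book states (e) for every `ε < ½` (via the sharper middle term
  `1 − (1 − d̄(t))²` of Lemma 6.17 and the Erdős–Rényi asymptotics (2.25)); typed is the range `ε < ¼`
  that the elementary chain `s(2t) ≤ 4d(t)` and the Chebyshev tail give, with explicit constants.

Context (cell pub-lqcd, venture LatticeQCDFlow): a universal, computable lower bound for single-site
heat-bath dynamics of monotone systems from the ordered start — no faster than coupon collecting over
the sites — the baseline against which sweep / cluster / flow proposals are costed.
-/

namespace Literature.Probability.MarkovChains

open Finset Function

variable {V S : Type*} [Fintype V] [DecidableEq V] [Fintype S] [DecidableEq S] [LinearOrder S]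

/-! ## Linearity of one step and the random-scan expansion -/

section Expansion

variable (π : (V → S) → ℝ)

omit [LinearOrder S] in
/-- One step of the random-scan dynamics is the average of the single-site steps:
`μP = |V|⁻¹ Σ_v μP_v`. [cite: LevinPeres2017, §3.3.2 (`P(x,y) = |V|⁻¹ Σ_v π_{x,v}(y)`)] -/
theorem stepLaw_glauberKernel (μ : (V → S) → ℝ) :
    stepLaw (glauberKernel π) μ =
      fun σ => (Fintype.card V : ℝ)⁻¹ * ∑ v, stepLaw (fun x y => glauberSiteLaw π x v y) μ σ := by
  funext σ
  simp only [stepLaw, glauberKernel_apply, Finset.mul_sum]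
  rw [Finset.sum_comm]
  exact sum_congr rfl fun v _ => sum_congr rfl fun x _ => by ring

omit [LinearOrder S] in
/-- The fold `μ ↦ μ P_{v₁} ⋯ P_{v_k}` is linear: it commutes with `c · Σ_i`. [folklore] -/
private theorem foldl_update_linear {ι : Type*} (s : Finset ι) (c : ℝ) (L : List V)
    (m : ι → (V → S) → ℝ) :
    L.foldl (fun μ v => stepLaw (fun x y => glauberSiteLaw π x v y) μ) (fun x => c * ∑ i ∈ s, m i x)
      = fun y => c * ∑ i ∈ s,
          L.foldl (fun μ v => stepLaw (fun x y => glauberSiteLaw π x v y) μ) (m i) y := by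
  induction L generalizing m with
  | nil => rfl
  | cons w L ih =>
      simp only [List.foldl_cons]
      have e : stepLaw (fun x y => glauberSiteLaw π x w y) (fun x => c * ∑ i ∈ s, m i x)
          = fun y => c * ∑ i ∈ s, stepLaw (fun x y => glauberSiteLaw π x w y) (m i) y := by
        funext y
        simp only [stepLaw, Finset.sum_mul, Finset.mul_sum]
        rw [Finset.sum_comm]
        exact sum_congr rfl fun i _ => sum_congr rfl fun x _ => by ring
      rw [e]
      exact ih (fun i => stepLaw (fun x y => glauberSiteLaw π x w y) (m i))

omit [LinearOrder S] in
/-- **Random-scan expansion.**  With `μ_{v₁…v_t} := μ P_{v₁} ⋯ P_{v_t}` (`List.foldl` of the single-site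
steps over the list of sites), `μ Pᵗ = |V|^{−t} Σ_{(v₁,…,v_t) ∈ Vᵗ} μ_{v₁…v_t}` (sequences as
`f : Fin t → V`, the list being `List.ofFn f`). [cite: LevinPeres2017, §22.9 Exercise 22.7 (b) hint
("Condition on the sequence of updated vertices")] -/
theorem lawAt_glauberKernel_eq_avg (μ : (V → S) → ℝ) (t : ℕ) :
    lawAt (glauberKernel π) μ t = fun σ => ((Fintype.card V : ℝ)⁻¹) ^ t *
      ∑ f : Fin t → V, (List.ofFn f).foldl
        (fun m v => stepLaw (fun x y => glauberSiteLaw π x v y) m) μ σ := by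
  induction t generalizing μ with
  | zero =>
      funext σ
      simp [lawAt_zero]
  | succ t ih =>
      have hstep : lawAt (glauberKernel π) μ (t + 1)
          = lawAt (glauberKernel π) (stepLaw (glauberKernel π) μ) t := by
        rw [show t + 1 = 1 + t by omega, lawAt_add, lawAt_succ, lawAt_zero]
      rw [hstep, ih, stepLaw_glauberKernel]
      funext σ
      -- push the inner average through the (linear) fold
      have hlin : ∀ f : Fin t → V,
          (List.ofFn f).foldl (fun m v => stepLaw (fun x y => glauberSiteLaw π x v y) m)
              (fun x => (Fintype.card V : ℝ)⁻¹ *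
                ∑ v, stepLaw (fun x y => glauberSiteLaw π x v y) μ x) σ
            = (Fintype.card V : ℝ)⁻¹ * ∑ v, (List.ofFn f).foldl
                (fun m v => stepLaw (fun x y => glauberSiteLaw π x v y) m)
                (stepLaw (fun x y => glauberSiteLaw π x v y) μ) σ := fun f =>
        congr_fun (foldl_update_linear π univ _ (List.ofFn f)
          (fun v => stepLaw (fun x y => glauberSiteLaw π x v y) μ)) σ
      simp only [hlin]
      -- regroup `(f', v) ↔ Fin.cons v f'`
      rw [← Finset.mul_sum, pow_succ, mul_assoc]
      congr 1
      rw [Finset.sum_comm]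
      have hcons : ∀ (v : V) (f' : Fin t → V),
          (List.ofFn (Fin.cons v f' : Fin (t + 1) → V)).foldl
              (fun m v => stepLaw (fun x y => glauberSiteLaw π x v y) m) μ
            = (List.ofFn f').foldl (fun m v => stepLaw (fun x y => glauberSiteLaw π x v y) m)
                (stepLaw (fun x y => glauberSiteLaw π x v y) μ) := by
        intro v f'
        rw [List.ofFn_succ]
        simp
      have hsplit : ∑ f : Fin (t + 1) → V, (List.ofFn f).foldl
            (fun m v => stepLaw (fun x y => glauberSiteLaw π x v y) m) μ σ
          = ∑ v : V, ∑ f' : Fin t → V, (List.ofFn (Fin.cons v f' : Fin (t + 1) → V)).foldl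
              (fun m v => stepLaw (fun x y => glauberSiteLaw π x v y) m) μ σ := by
        rw [← Fintype.sum_prod_type']
        exact (Fintype.sum_equiv (Fin.consEquiv fun _ => V)
          (fun p => (List.ofFn (Fin.cons p.1 p.2 : Fin (t + 1) → V)).foldl
              (fun m v => stepLaw (fun x y => glauberSiteLaw π x v y) m) μ σ)
          (fun f => (List.ofFn f).foldl (fun m v => stepLaw (fun x y => glauberSiteLaw π x v y) m) μ σ)
          (fun p => rfl)).symm
      rw [hsplit]
      simp only [hcons]

omit [LinearOrder S] in
/-- `Pᵗ(x, σ)` in the expansion: `Pᵗ(x,σ) = |V|^{−t} Σ_f (δ_x)_{f}(σ)`.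
[cite: LevinPeres2017, §22.9 Exercise 22.7 (b) hint] -/
theorem kernelAt_glauberKernel_eq_avg (x σ : V → S) (t : ℕ) :
    kernelAt (glauberKernel π) t x σ = ((Fintype.card V : ℝ)⁻¹) ^ t *
      ∑ f : Fin t → V, (List.ofFn f).foldl
        (fun m v => stepLaw (fun x y => glauberSiteLaw π x v y) m) (Pi.single x 1) σ := by
  unfold kernelAt
  rw [lawAt_glauberKernel_eq_avg]

end Expansion

/-! ## Support: sites never updated keep their initial spin -/

section Support

variable {π : (V → S) → ℝ}

omit [LinearOrder S] in
/-- If `ν` charges only configurations with `σ(w) = a` and `v ≠ w`, then so does `νP_v` (the update at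
`v` does not touch the spin at `w`). [cite: LevinPeres2017, §22.9 Exercise 22.7 (b) (conditioning on
the updated vertices: an un-refreshed vertex keeps its spin)] -/
theorem stepLaw_siteLaw_apply_eq_zero {ν : (V → S) → ℝ} {w : V} {a : S}
    (hν : ∀ σ, σ w ≠ a → ν σ = 0) {v : V} (hvw : v ≠ w) (σ : V → S) (hσ : σ w ≠ a) :
    stepLaw (fun x y => glauberSiteLaw π x v y) ν σ = 0 := by
  unfold stepLaw
  refine sum_eq_zero fun x _ => ?_
  change ν x * glauberSiteLaw π x v σ = 0
  by_cases hx : x w = a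
  · -- then `x` and `σ` differ at `w ≠ v`, so `P_v(x, σ) = 0`
    have hna : ¬ AgreeOff x v σ := fun h => hσ (by rw [h w (Ne.symm hvw)]; exact hx)
    unfold glauberSiteLaw
    rw [if_neg hna, mul_zero]
  · rw [hν x hx, zero_mul]

omit [LinearOrder S] in
/-- Iterating: after updates at the sites of `L` from a law supported on `{σ(w) = a}`, with `w ∉ L`,
the law is still supported there. [cite: LevinPeres2017, §22.9 Exercise 22.7 (b)] -/
theorem foldl_update_apply_eq_zero {ν : (V → S) → ℝ} {w : V} {a : S}
    (hν : ∀ σ, σ w ≠ a → ν σ = 0) (L : List V) (hL : w ∉ L) (σ : V → S) (hσ : σ w ≠ a) :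
    L.foldl (fun m v => stepLaw (fun x y => glauberSiteLaw π x v y) m) ν σ = 0 := by
  induction L generalizing ν with
  | nil => exact hν σ hσ
  | cons v L ih =>
      rw [List.foldl_cons]
      have hvw : v ≠ w := fun h => hL (by rw [h]; exact List.mem_cons_self)
      have hwL : w ∉ L := fun h => hL (List.mem_cons_of_mem v h)
      exact ih (fun τ hτ => stepLaw_siteLaw_apply_eq_zero hν hvw τ hτ) hwL

end Support

/-! ## (a): from the top state, `μ_t/π` stays increasing and `μ_t(⊖) ≤ π(⊖)` -/

section PartA

variable {π : (V → S) → ℝ}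

omit [DecidableEq V] [Fintype S] in
/-- `δ_⊕/π` is increasing when `⊕` is the largest configuration. [cite: LevinPeres2017, §22.9
Exercise 22.7 (a) (start "at the all plus state ⊕")] -/
theorem monotone_single_constTop_div (hπ : ∀ x, 0 < π x) {top : S} (htop : ∀ s, s ≤ top) :
    Monotone (fun σ : V → S => (Pi.single (fun _ => top) 1 : (V → S) → ℝ) σ / π σ) := by
  intro σ τ hστ
  by_cases hσ : σ = fun _ => top
  · have hτ : τ = fun _ => top := by
      funext w
      exact le_antisymm (htop _) (by have := hστ w; rw [hσ] at this; exact this)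
    rw [hσ, hτ]
  · show (Pi.single (fun _ => top) 1 : (V → S) → ℝ) σ / π σ ≤ (Pi.single (fun _ => top) 1 : (V → S) → ℝ) τ / π τ
    rw [Pi.single_apply, if_neg hσ, zero_div]
    refine div_nonneg ?_ (hπ τ).le
    rw [Pi.single_apply]
    split_ifs <;> norm_num

/-- "Apply Lemma 22.21 `t` times": for a monotone system, after any sequence of single-site updates
from `⊕`, `μ_{v₁…v_t}/π` is increasing. [cite: LevinPeres2017, §22.9 Exercise 22.7 (a) hint] -/
theorem monotone_foldl_update_div (hπ : ∀ x, 0 < π x)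
    (hmono : ∀ v, IsMonotoneChain (fun x y : V → S => glauberSiteLaw π x v y))
    {ν : (V → S) → ℝ} (hν : Monotone (fun σ => ν σ / π σ)) (L : List V) :
    Monotone (fun σ => L.foldl (fun m v => stepLaw (fun x y => glauberSiteLaw π x v y) m) ν σ / π σ) := by
  induction L generalizing ν with
  | nil => exact hν
  | cons v L ih =>
      rw [List.foldl_cons]
      exact ih (LevinPeres2017_lemma_22_21 hπ (hmono v) hν)

omit [LinearOrder S] in
/-- The folds preserve total mass. [folklore] -/
private theorem sum_foldl_siteUpdate (hπ : ∀ x, 0 < π x) (ν : (V → S) → ℝ) (L : List V) :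
    ∑ σ, L.foldl (fun m v => stepLaw (fun x y => glauberSiteLaw π x v y) m) ν σ = ∑ σ, ν σ := by
  induction L generalizing ν with
  | nil => rfl
  | cons v L ih =>
      rw [List.foldl_cons, ih, sum_stepLaw (siteLaw_isRowStochastic hπ v)]

/-- **Exercise 22.7 (a).**  For a monotone single-site heat-bath system (`π > 0`, every `P_v` monotone)
with a top spin, the law `μ_t` after updates at `v₁, …, v_t` from the all-top state `⊕` satisfies
`μ_t(⊖) ≤ π(⊖)` at the all-bottom state — indeed at every state `η` below all others.
[cite: LevinPeres2017, §22.9 Exercise 22.7 (a)] -/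
theorem LevinPeres2017_exercise_22_7_a (hπ : ∀ x, 0 < π x) (hπ1 : ∑ x, π x = 1)
    (hmono : ∀ v, IsMonotoneChain (fun x y : V → S => glauberSiteLaw π x v y))
    {top : S} (htop : ∀ s, s ≤ top) {η : V → S} (hη : ∀ σ, η ≤ σ) (L : List V) :
    L.foldl (fun m v => stepLaw (fun x y => glauberSiteLaw π x v y) m)
        (Pi.single (fun _ => top) 1) η ≤ π η := by
  set μ := L.foldl (fun m v => stepLaw (fun x y => glauberSiteLaw π x v y) m)
    (Pi.single (fun _ => top) (1 : ℝ)) with hμ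
  have hr : Monotone (fun σ => μ σ / π σ) :=
    monotone_foldl_update_div hπ hmono (monotone_single_constTop_div hπ htop) L
  have hmass : ∑ σ, μ σ = 1 := by
    rw [hμ, sum_foldl_siteUpdate hπ]
    simp
  -- `μ(η)/π(η) = Σ_σ π(σ) · μ(η)/π(η) ≤ Σ_σ π(σ) · μ(σ)/π(σ) = Σ μ = 1`
  have hle : μ η / π η ≤ 1 := by
    calc μ η / π η = ∑ σ, π σ * (μ η / π η) := by rw [← sum_mul, hπ1, one_mul]
      _ ≤ ∑ σ, π σ * (μ σ / π σ) :=
          sum_le_sum fun σ _ => mul_le_mul_of_nonneg_left (hr (hη σ)) (hπ σ).le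
      _ = ∑ σ, μ σ := sum_congr rfl fun σ _ => by field_simp [(hπ σ).ne']
      _ = 1 := hmass
  rwa [div_le_one (hπ η)] at hle

end PartA

/-! ## (b)–(c): `Pᵗ(⊕,⊖) ≤ π(⊖)·P{τ_cov ≤ t}` and `s(t) ≥ 1 − P{τ_cov ≤ t}` -/

section PartBC

variable {π : (V → S) → ℝ}

/-- **Exercise 22.7 (b).**  `Pᵗ(⊕,⊖) ≤ π(⊖) · N_cov(t)/|V|ᵗ`, where `N_cov(t)` counts the site
sequences `(v₁,…,v_t)` covering `V` — i.e. `Pᵗ(⊕,⊖) ≤ π(⊖)·P{τ_cov ≤ t}` with `τ_cov` the covering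
(coupon-collector) time of the uniform site choices: sequences missing a site give `⊖` no mass, covering
ones give it at most `π(⊖)` by part (a). [cite: LevinPeres2017, §22.9 Exercise 22.7 (b)–(c) hint
(`Pᵗ(⊕,⊖) = P{τ ≤ t}·P_⊕{X_t = ⊖ | τ ≤ t}` and `P_⊕{X_t = ⊖ | τ ≤ t} ≤ π(⊖)`)] -/
theorem LevinPeres2017_exercise_22_7_b (hπ : ∀ x, 0 < π x) (hπ1 : ∑ x, π x = 1)
    (hmono : ∀ v, IsMonotoneChain (fun x y : V → S => glauberSiteLaw π x v y))
    {top bot : S} (htop : ∀ s, s ≤ top) (hbot : ∀ s, bot ≤ s) (hne : bot ≠ top) (t : ℕ) :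
    kernelAt (glauberKernel π) t (fun _ => top) (fun _ => bot) ≤
      π (fun _ => bot) * ((Nat.card {f : Fin t → V // Function.Surjective f} : ℝ) /
        (Fintype.card V : ℝ) ^ t) := by
  classical
  rw [kernelAt_glauberKernel_eq_avg]
  set F : (Fin t → V) → ℝ := fun f => (List.ofFn f).foldl
    (fun m v => stepLaw (fun x y => glauberSiteLaw π x v y) m)
    (Pi.single (fun _ => top) (1 : ℝ)) (fun _ => bot) with hF
  -- each term: `0` if `f` is not onto, `≤ π(⊖)` if it is
  have hterm : ∀ f : Fin t → V, F f ≤ if Function.Surjective f then π (fun _ => bot) else 0 := by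
    intro f
    split_ifs with hs
    · exact LevinPeres2017_exercise_22_7_a hπ hπ1 hmono htop (fun σ w => hbot (σ w)) (List.ofFn f)
    · -- some site `w` is never updated; `⊖(w) = bot ≠ top`
      obtain ⟨w, hw⟩ : ∃ w, ∀ i, f i ≠ w := by
        simpa [Function.Surjective] using hs
      have hwL : w ∉ List.ofFn f := by
        rw [List.mem_ofFn]; rintro ⟨i, hi⟩; exact hw i hi
      have h0 : (List.ofFn f).foldl (fun m v => stepLaw (fun x y => glauberSiteLaw π x v y) m)
          (Pi.single (fun _ => top) (1 : ℝ)) (fun _ => bot) = 0 :=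
        foldl_update_apply_eq_zero (ν := Pi.single (fun _ => top) (1 : ℝ)) (w := w) (a := top)
          (fun σ hσ => by
            rw [Pi.single_apply, if_neg]
            intro h
            exact hσ (by rw [h]))
          (List.ofFn f) hwL (fun _ => bot) hne
      exact le_of_eq h0
  have hsum : ∑ f : Fin t → V, F f ≤ (Nat.card {f : Fin t → V // Function.Surjective f} : ℝ) *
      π (fun _ => bot) := by
    calc ∑ f, F f ≤ ∑ f : Fin t → V, (if Function.Surjective f then π (fun _ => bot) else 0) :=
          sum_le_sum fun f _ => hterm f
      _ = ((univ.filter fun f : Fin t → V => Function.Surjective f).card : ℝ) * π (fun _ => bot) := by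
          rw [Finset.sum_ite, Finset.sum_const_zero, add_zero, Finset.sum_const, nsmul_eq_mul]
      _ = (Nat.card {f : Fin t → V // Function.Surjective f} : ℝ) * π (fun _ => bot) := by
          congr 1
          rw [Nat.card_eq_fintype_card, Fintype.card_subtype]
  have hc : 0 ≤ ((Fintype.card V : ℝ)⁻¹) ^ t := pow_nonneg (inv_nonneg.mpr (Nat.cast_nonneg _)) t
  calc ((Fintype.card V : ℝ)⁻¹) ^ t * ∑ f, F f
      ≤ ((Fintype.card V : ℝ)⁻¹) ^ t *
          ((Nat.card {f : Fin t → V // Function.Surjective f} : ℝ) * π (fun _ => bot)) :=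
        mul_le_mul_of_nonneg_left hsum hc
    _ = π (fun _ => bot) * ((Nat.card {f : Fin t → V // Function.Surjective f} : ℝ) /
          (Fintype.card V : ℝ) ^ t) := by
        rw [inv_pow]; ring

/-- **Exercise 22.7 (c).**  `s(t) ≥ s_⊕(t) ≥ 1 − Pᵗ(⊕,⊖)/π(⊖) ≥ 1 − N_cov(t)/|V|ᵗ = 1 − P{τ_cov ≤ t}`.
[cite: LevinPeres2017, §22.9 Exercise 22.7 (c)] -/
theorem LevinPeres2017_exercise_22_7_c (hπ : ∀ x, 0 < π x) (hπ1 : ∑ x, π x = 1)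
    (hmono : ∀ v, IsMonotoneChain (fun x y : V → S => glauberSiteLaw π x v y))
    {top bot : S} (htop : ∀ s, s ≤ top) (hbot : ∀ s, bot ≤ s) (hne : bot ≠ top) (t : ℕ) :
    1 - (Nat.card {f : Fin t → V // Function.Surjective f} : ℝ) / (Fintype.card V : ℝ) ^ t ≤
      sepDistFrom (glauberKernel π) π (fun _ => top) t ∧
    sepDistFrom (glauberKernel π) π (fun _ => top) t ≤ sepDist (glauberKernel π) π t := by
  refine ⟨?_, sepDistFrom_le_sepDist _ _ _ _⟩
  have hb := LevinPeres2017_exercise_22_7_b hπ hπ1 hmono htop hbot hne t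
  have hπb := hπ (fun _ => bot)
  have hratio : kernelAt (glauberKernel π) t (fun _ => top) (fun _ => bot) / π (fun _ => bot) ≤
      (Nat.card {f : Fin t → V // Function.Surjective f} : ℝ) / (Fintype.card V : ℝ) ^ t := by
    rw [div_le_iff₀ hπb]
    linarith
  have hs := le_sepDistFrom (glauberKernel π) π (fun _ => top) t (fun _ => bot)
  linarith

/-- With LEMMA 6.17 (`s(2t) ≤ 1 − (1 − d̄(t))² ≤ 2d̄(t) ≤ 4d(t)`, the heat-bath dynamics being reversible
with respect to `π`): **`1 − N_cov(2t)/|V|^{2t} ≤ 4·d(t)`**, i.e. `d(t) ≥ (1 − P{τ_cov ≤ 2t})/4`.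
[cite: LevinPeres2017, §22.9 Exercise 22.7 (e) hint ("Use Lemma 6.17") with §6.4 Lemma 6.17] -/
theorem LevinPeres2017_exercise_22_7_tv [Nonempty V] (hπ : ∀ x, 0 < π x) (hπ1 : ∑ x, π x = 1)
    (hmono : ∀ v, IsMonotoneChain (fun x y : V → S => glauberSiteLaw π x v y))
    {top bot : S} (htop : ∀ s, s ≤ top) (hbot : ∀ s, bot ≤ s) (hne : bot ≠ top) (t : ℕ) :
    1 - (Nat.card {f : Fin (2 * t) → V // Function.Surjective f} : ℝ) / (Fintype.card V : ℝ) ^ (2 * t)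
      ≤ 4 * worstTvDist (glauberKernel π) π t := by
  obtain ⟨h1, h2⟩ := LevinPeres2017_exercise_22_7_c hπ hπ1 hmono htop hbot hne (2 * t)
  obtain ⟨h3, h4, h5⟩ := LevinPeres2017_lemma_6_17 (glauberKernel_isRowStochastic hπ)
    (glauberKernel_detailedBalance π) hπ hπ1 t
  linarith

end PartBC

/-! ## (d)–(e): explicit constants through the coupon-collector tail -/

section PartDE

variable {π : (V → S) → ℝ}

/-- **Exercise 22.7 (d).**  For a monotone single-site heat-bath system on `n = |V| ≥ 2` sites, started
from `⊕`: `s(t) ≥ 1 − e^{−c}` for every `t ≤ (n − 1)(log n − c)`.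
[cite: LevinPeres2017, §22.9 Exercise 22.7 (d)] -/
theorem LevinPeres2017_exercise_22_7_d [Nontrivial V] (hπ : ∀ x, 0 < π x) (hπ1 : ∑ x, π x = 1)
    (hmono : ∀ v, IsMonotoneChain (fun x y : V → S => glauberSiteLaw π x v y))
    {top bot : S} (htop : ∀ s, s ≤ top) (hbot : ∀ s, bot ≤ s) (hne : bot ≠ top) {t : ℕ} {c : ℝ}
    (ht : (t : ℝ) ≤ ((Fintype.card V : ℝ) - 1) * (Real.log (Fintype.card V : ℝ) - c)) :
    1 - Real.exp (-c) ≤ sepDist (glauberKernel π) π t := by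
  obtain ⟨h1, h2⟩ := LevinPeres2017_exercise_22_7_c hπ hπ1 hmono htop hbot hne t
  have h3 := couponCollector_cover_le_exp (V := V) ht
  linarith

/-- **Exercise 22.7 (e).**  Same setting: `4·d(t) ≥ 1 − e^{−c}` whenever `2t ≤ (n − 1)(log n − c)`; hence
`t < t_mix(ε)` for every such `t` as soon as `e^{−c} < 1 − 4ε` (given that `d(s) ≤ ε` for some `s`, so
that `t_mix(ε)` is attained) — `t_mix(ε) ≥ ½(n−1)(log n − log(1/(1−4ε)))`, the printed
"`t_mix(ε) ≥ n log(n)/2 − O(n)`" with explicit constants for `ε < ¼`.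
[cite: LevinPeres2017, §22.9 Exercise 22.7 (e)] -/
theorem LevinPeres2017_exercise_22_7_e [Nontrivial V] (hπ : ∀ x, 0 < π x) (hπ1 : ∑ x, π x = 1)
    (hmono : ∀ v, IsMonotoneChain (fun x y : V → S => glauberSiteLaw π x v y))
    {top bot : S} (htop : ∀ s, s ≤ top) (hbot : ∀ s, bot ≤ s) (hne : bot ≠ top) {t : ℕ} {c : ℝ}
    (ht : (((2 * t : ℕ)) : ℝ) ≤ ((Fintype.card V : ℝ) - 1) * (Real.log (Fintype.card V : ℝ) - c)) :
    1 - Real.exp (-c) ≤ 4 * worstTvDist (glauberKernel π) π t ∧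
      ∀ ε : ℝ, Real.exp (-c) < 1 - 4 * ε → (∃ s, worstTvDist (glauberKernel π) π s ≤ ε) →
        t < mixingTime (glauberKernel π) π ε := by
  haveI : Nonempty V := inferInstance
  have htv := LevinPeres2017_exercise_22_7_tv hπ hπ1 hmono htop hbot hne t
  have h3 := couponCollector_cover_le_exp (V := V) ht
  have hd : 1 - Real.exp (-c) ≤ 4 * worstTvDist (glauberKernel π) π t := by linarith
  refine ⟨hd, fun ε hε hmix => ?_⟩
  by_contra hle
  push Not at hle
  obtain ⟨s₀, hs₀⟩ := hmix
  have hP := glauberKernel_isRowStochastic hπ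
  have hst : IsStationary π (glauberKernel π) := (glauberKernel_detailedBalance π).isStationary hP.2
  have := worstTvDist_le_of_mixingTime_le hP hst hs₀ hle
  linarith

end PartDE

/-! ## The Ising model -/

section Ising

variable {G : SimpleGraph V} [DecidableRel G.Adj]

/-- **Exercise 22.7 for the Glauber dynamics of the ferromagnetic Ising model** (`β ≥ 0`, any finite
graph with a vertex): from the all-plus state, `Pᵗ(⊕,⊖) ≤ π(⊖)·N_cov(t)/|V|ᵗ`,
`s(t) ≥ 1 − N_cov(t)/|V|ᵗ` and `4d(t) ≥ 1 − N_cov(2t)/|V|^{2t}` (monotonicity of the site kernels: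
Example 22.9). [cite: LevinPeres2017, §22.9 Exercise 22.7 (a)–(c), (e) hint] -/
theorem LevinPeres2017_exercise_22_7_ising [Nonempty V] {β : ℝ} (hβ : 0 ≤ β) (t : ℕ) :
    kernelAt (glauberKernel (gibbsLaw G β)) t (fun _ => 1) (fun _ => -1) ≤
        gibbsLaw G β (fun _ => -1) * ((Nat.card {f : Fin t → V // Function.Surjective f} : ℝ) /
          (Fintype.card V : ℝ) ^ t) ∧
      1 - (Nat.card {f : Fin t → V // Function.Surjective f} : ℝ) / (Fintype.card V : ℝ) ^ t ≤
        sepDist (glauberKernel (gibbsLaw G β)) (gibbsLaw G β) t ∧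
      1 - (Nat.card {f : Fin (2 * t) → V // Function.Surjective f} : ℝ) /
          (Fintype.card V : ℝ) ^ (2 * t) ≤
        4 * worstTvDist (glauberKernel (gibbsLaw G β)) (gibbsLaw G β) t := by
  have hπ := gibbsLaw_pos (G := G) β
  have hπ1 := sum_gibbsLaw (G := G) β
  have hmono : ∀ v, IsMonotoneChain (fun x y : V → ℤˣ => glauberSiteLaw (gibbsLaw G β) x v y) :=
    fun v f hf => LevinPeres2017_example_22_9 (G := G) hβ v f hf
  have htop : ∀ s : ℤˣ, s ≤ 1 := fun s => by
    rcases Int.units_eq_one_or s with h | h <;> subst h <;> decide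
  have hbot : ∀ s : ℤˣ, -1 ≤ s := fun s => by
    rcases Int.units_eq_one_or s with h | h <;> subst h <;> decide
  have hne : (-1 : ℤˣ) ≠ 1 := by decide
  obtain ⟨hc1, hc2⟩ := LevinPeres2017_exercise_22_7_c hπ hπ1 hmono htop hbot hne t
  exact ⟨LevinPeres2017_exercise_22_7_b hπ hπ1 hmono htop hbot hne t, hc1.trans hc2,
    LevinPeres2017_exercise_22_7_tv hπ hπ1 hmono htop hbot hne t⟩

/-- **Exercise 22.7 (e) for the Ising model**: for the Glauber dynamics of the ferromagnetic Ising model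
on any finite graph with `n ≥ 2` vertices, `t_mix(ε) > t` whenever `2t ≤ (n−1)(log n − c)` and
`e^{−c} < 1 − 4ε` (the dynamics converges, so `t_mix(ε)` is attained for `ε > 0`):
"`t_mix(ε) ≥ n log(n)/2 − O(n)`". [cite: LevinPeres2017, §22.9 Exercise 22.7 (e)] -/
theorem LevinPeres2017_exercise_22_7_ising_tmix [Nontrivial V] {β : ℝ} (hβ : 0 ≤ β) {t : ℕ} {c ε : ℝ}
    (ht : (((2 * t : ℕ)) : ℝ) ≤ ((Fintype.card V : ℝ) - 1) * (Real.log (Fintype.card V : ℝ) - c))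
    (hε : Real.exp (-c) < 1 - 4 * ε)
    (hmix : ∃ s, worstTvDist (glauberKernel (gibbsLaw G β)) (gibbsLaw G β) s ≤ ε) :
    t < mixingTime (glauberKernel (gibbsLaw G β)) (gibbsLaw G β) ε := by
  have hπ := gibbsLaw_pos (G := G) β
  have hπ1 := sum_gibbsLaw (G := G) β
  have hmono : ∀ v, IsMonotoneChain (fun x y : V → ℤˣ => glauberSiteLaw (gibbsLaw G β) x v y) :=
    fun v f hf => LevinPeres2017_example_22_9 (G := G) hβ v f hf
  have htop : ∀ s : ℤˣ, s ≤ 1 := fun s => by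
    rcases Int.units_eq_one_or s with h | h <;> subst h <;> decide
  have hbot : ∀ s : ℤˣ, -1 ≤ s := fun s => by
    rcases Int.units_eq_one_or s with h | h <;> subst h <;> decide
  have hne : (-1 : ℤˣ) ≠ 1 := by decide
  exact (LevinPeres2017_exercise_22_7_e hπ hπ1 hmono htop hbot hne ht).2 ε hε hmix

end Ising

end Literature.Probability.MarkovChains
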